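import Summits.BirchSwinnertonDyer.BirchSwinnertonDyer.Theorems.CyclotomicUntwistInertiaWildAtThreeTransport
import Summits.BirchSwinnertonDyer.BirchSwinnertonDyer.Theorems.CyclotomicUntwistInertiaWildAtThreeLevel
import Literature.NumberTheory.EllipticCurves.TateModuleTwistNewformEulerFactorsProofs
import Literature.NumberTheory.EllipticCurves.NewformGaloisRepEulerFactors
import Literature.NumberTheory.EllipticCurves.EisensteinNewformLevelRaising
import Literature.NumberTheory.EllipticCurves.NonsplitNodeConductor
import Literature.NumberTheory.EllipticCurves.ModularCurve
import HarnessLib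

/-!
# Wild inertia at `3` on the principal-series rows: the binder `hwild` of the ROOT LAW (T), discharged
# from Carayol's Euler factors (print layer (T) of crux child C1, Galois half)

Cell `pub/bsd-wall` (D-0145 line `route-BirchSwinnertonDyer-CyclotomicUntwist`), seat `bsd-line-cycu-p3`
(gen 10). THEOREMS ONLY (no definition, no named fact, no `sorry`); helper toward the crux child
C1 = stmt-BirchSwinnertonDyer-27548 (`PSUntwistedLFunctionAtThree`). BSD is not proved by this file; no crux
and no child of the route is proved by it; the two named PRINT inputs (Deligne/Ribet through Hida 2000
Thm. 3.26 (1), `Hida2000_thm326_exists_galoisRep`; Carayol 1986 Thm. (A), `Carayol1986_eulerFactor`) are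
hypotheses, exactly those of the K1 lead's uniform root law (cycu-p1 g8, files
`CyclotomicUntwistCoinvariantEigenvalue` p646654, `CyclotomicUntwistInertiaOverCyclotomicNine` p647742).

WHAT. The lead's file 3 `uniformRootLaw_of_print` carries the Galois binder

  `hwild : ∃ v 𝔓, 𝔓 ∈ v.primesAbove ∧ (3 : 𝓞 ℚ) ∈ v.asIdeal ∧
             ∃ i ∈ 𝔓.inertia Γ_ℚ, W.rationalGaloisRepTate 2 i ^ 3 = 1 ∧ W.rationalGaloisRepTate 2 i ≠ 1`

(«an inertia element at `3` acts on `V₂(W)` with exact order `3`», i.e. the `ℓ`-adic inertia image at `3`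
is WILD). This file PROVES it on every principal-series row (`ClassO6 W 3`, `v₃(Δ_min)` even, unit part
`≡ 1 (mod 3)`), for every `ℓ ≠ 3` (`hwild_of_classO6_of_print`, and `hwild_two_of_classO6_of_print` in the
lead's `ℓ = 2` shape), from modularity of `W` (`f` with `IsNewformOf W f`, `N = N_W`) and the two print facts,
WITHOUT the Artin-conductor/Ogg–Saito identification of `N_W`:

* take `τ ∈ I_𝔓` with `χ₉(τ) = 2` (lead, file 2); `ρ(τ)⁶ = 1` since `τ⁶` fixes `ζ₉`; put `i = τ²`;
* (A) `ρ(τ) − 1` is injective (`forall_eq_zero_of_rationalGaloisRepTate_apply_eq_self`): the engine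
  `map_reverse_charpoly_toInertiaCoinvariants_twist_eq` with the TRIVIAL twist and Carayol for the lift of
  `f_W` give the coinvariant Euler factor `1 − a₃(W)T + ε(3)·3T² = 1` (`a₃(W) = 0`, `ε(3) = 0` as `3 ∣ N`),
  so `(V_ℓW)_{I_𝔓} = 0`, i.e. `ρ(τ) − 1` is onto (cyclic inertia through `τ`, lead's
  `finrank_coinvariants_eq_finrank_ker`), hence injective;
* (B) `ρ(τ) ≠ −1` (`rationalGaloisRepTate_ne_neg_one`): otherwise `V_ℓW ⊗ ψ₃` (`ψ₃ = (·/3)`,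
  `ψ₃(χ₃ τ) = ψ₃(2) = −1`) is trivial on `I_𝔓`, its coinvariants are everything, and the engine + Carayol for
  the newform `g₀` of `f_W ⊗ ψ₃` (trivial nebentypus, companion file) give `ε_{g₀}(3)·3 = det ≠ 0`, so
  `3 ∤ N₀` — against `three_dvd_level_of_psiThree_packet` (companion file: untwist + Γ₀ strong multiplicity
  one + `27 ∣ N_W` on `ClassO6`);
* so `ρ(τ)² ≠ 1` (else `(ρτ − 1)(ρτ + 1) = 0` forces `ρτ = −1`), and `i = τ²` has `ρ(i)³ = 1 ≠ ρ(i)`.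

References: [cite: CarayolASENS1986, Thm. (A)] · [cite: Hida2000, Thm. 3.26 (1)] ·
[cite: SerreTate1968, §1–§2] · [cite: SilvermanAEC2009, Prop. VII.4.1] · [cite: DiamondShurman2005, Thm. 5.8.2–5.8.3].
-/

set_option autoImplicit false
-- single-conjunct summit: `Summit.BirchSwinnertonDyer.BirchSwinnertonDyer.…` repeats the name by design
set_option linter.dupNamespace false

noncomputable section

open scoped NumberField MatrixGroups Matrix
open Polynomial NumberField IsDedekindDomain IsDedekindDomain.HeightOneSpectrum Field
  Rat.HeightOneSpectrum CongruenceSubgroup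
  Literature.NumberTheory.GaloisRepresentations Literature.NumberTheory.EllipticCurves
  Literature.NumberTheory.EllipticCurves.ModularForms Literature.NumberTheory.Automorphic.BCDT
  Summit.BirchSwinnertonDyer.Rank1Residual.Additive
  Summit.BirchSwinnertonDyer.BirchSwinnertonDyer.Theorems.InertiaOverCyclotomicNine
  Summit.BirchSwinnertonDyer.BirchSwinnertonDyer.Theorems.InertiaWildAtThreeLevel
  Summit.BirchSwinnertonDyer.BirchSwinnertonDyer.Theorems.InertiaWildAtThreeTransport

namespace Summit.BirchSwinnertonDyer.BirchSwinnertonDyer.Theorems.InertiaWildAtThree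

/-! ### §4 Claim (A): `ρ(τ) − 1` is injective — Carayol for the lift of `f_W`, trivial twist -/

section Claims

variable (W : WeierstrassCurve ℚ) [W.IsElliptic] [W.IsGloballyMinimal] (ℓ : ℕ) [Fact ℓ.Prime]

/-- At a place `v ∋ 3` of `ℚ`, the prime under `v` is `3` (as the value of `primesEquiv`). [folklore] -/
theorem coe_primesEquiv_eq_three {v : HeightOneSpectrum (𝓞 ℚ)} (hv : (3 : 𝓞 ℚ) ∈ v.asIdeal) :
    ((primesEquiv v : Nat.Primes) : ℕ) = 3 :=
  natGenerator_eq_three hv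

/-- **Claim (A): on a principal-series row `ρ(τ)` has no non-zero fixed vector on `V_ℓ(W)`** (`τ ∈ I_𝔓`,
`χ₉(τ) = 2`, `ℓ ≠ 3`), granted Deligne's representations and Carayol's Euler factors. Proof: for the lift
`g` of `f_W` to `Γ₁(N)` the engine `map_reverse_charpoly_toInertiaCoinvariants_twist_eq` (trivial twist) reads
Carayol's coinvariant Euler factor at `3` as `1 − a₃(W)T + ε_g(3)·3T² = 1` (`a₃(W) = 0` at the additive prime,
`ε_g(3) = 0` as `3 ∣ N`), so the inertia coinvariants of `V_ℓ(W) ⊗ ℚ̄_ℓ` vanish; as the inertia acts through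
the powers of `τ`, they have the dimension of `ker(ρ(τ) − 1)` (lead's `finrank_coinvariants_eq_finrank_ker`).
[cite: CarayolASENS1986, Thm. (A)] [cite: Hida2000, Thm. 3.26 (1)] -/
theorem forall_eq_zero_of_rationalGaloisRepTate_apply_eq_self
    (hDel : Hida2000_thm326_exists_galoisRep) (hCar : Carayol1986_eulerFactor)
    (hO6 : ClassO6 W 3) (hev : Even (padicValInt 3 W.minimalDiscriminantInt))
    (hsq : W.minimalDiscriminantInt / 3 ^ padicValInt 3 W.minimalDiscriminantInt % 3 = 1) (hℓ : ℓ ≠ 3)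
    {N : ℕ} [NeZero N] {f : CuspForm (Gamma0 N) 2} (hf : IsNewformOf W f) (h3N : 3 ∣ N)
    {v : HeightOneSpectrum (𝓞 ℚ)} (hv : (3 : 𝓞 ℚ) ∈ v.asIdeal)
    {𝔓 : Ideal (absIntegers (𝓞 ℚ) ℚ)} (h𝔓 : 𝔓 ∈ v.primesAbove)
    {τ : absoluteGaloisGroup ℚ} (hτ : τ ∈ 𝔓.inertia (absoluteGaloisGroup ℚ))
    (hχτ : (modNCyclotomicCharacter ℚ 9 τ : ZMod 9) = 2)
    (y : W.rationalTateModule ℓ) (hy : W.rationalGaloisRepTate ℓ τ y = y) : y = 0 := by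
  classical
  haveI : NeZero ((3 : ℕ) : ℚ) := ⟨by norm_num⟩
  haveI : 𝔓.IsPrime := h𝔓.1
  obtain ⟨ι⟩ := PadicAlgCl.nonempty_ringEquiv_complex ℓ
  obtain ⟨VQ, eV, heV, hV⟩ := exists_framedGaloisRep_rationalTate W ℓ
  obtain ⟨ψ, hψ, hψI, hψF⟩ := exists_psi_of_dirichletCharacter_three ℓ ι (1 : DirichletCharacter ℂ 3)
  -- the newform `g = lift f_W` and its packet (trivial twist)
  have hg : IsNewform1 (liftToGamma1 N 2 f) := (isNewform1_liftToGamma1_iff_holds (N := N) (k := 2) f).mpr hf.1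
  have hpk : ∀ p : ℕ, p.Prime → ¬ p ∣ N * 3 →
      cuspCoeff (liftToGamma1 N 2 f) p = (fun n : ℕ ↦ (1 : DirichletCharacter ℂ 3) (n : ZMod 3)) p * (W.LFunction p : ℂ) ∧
        (nebentypus (liftToGamma1 N 2 f) (p : ZMod N) : ℂ) = (fun n : ℕ ↦ (1 : DirichletCharacter ℂ 3) (n : ZMod 3)) p ^ 2 := by
    intro p hp hpN
    have hp3 : ¬ p ∣ 3 := fun h ↦ hpN (h.mul_left N)
    have hu3 : IsUnit ((p : ℕ) : ZMod 3) := (ZMod.isUnit_prime_iff_not_dvd hp).mpr hp3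
    obtain ⟨h1, h2⟩ := packet_liftToGamma1 hf p hp (fun h ↦ hpN (h.mul_right 3))
    simp only [MulChar.one_apply hu3]
    exact ⟨h1, h2⟩
  obtain ⟨ρg, hρg, hirr⟩ := hDel (liftToGamma1 N 2 f) le_rfl hg ℓ ι
  -- an arithmetic Frobenius at `𝔓`
  obtain ⟨φ₀, hφ₀⟩ := HeightOneSpectrum.exists_isArithFrobAt_of_mem_primesAbove_holds h𝔓
  have hφD : φ₀ ∈ 𝔓.decompositionSubgroup (absoluteGaloisGroup ℚ) := hφ₀.mem_stabilizer
  -- the engine: Carayol's coinvariant Euler factor of `V_ℓ(W) ⊗ 1` at `3`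
  have hE := map_reverse_charpoly_toInertiaCoinvariants_twist_eq W ℓ ι VQ hV 3
    (fun n : ℕ ↦ (1 : DirichletCharacter ℂ 3) (n : ZMod 3)) ψ hψI hψF (liftToGamma1 N 2 f) hg
    (T₀ := N * 3) (mul_ne_zero (NeZero.ne N) three_ne_zero) hpk ρg hρg hirr hCar
    (WeierstrassCurve.nodalCubic.natCast_not_mem_of_three_mem ℓ hℓ hv) h𝔓 ⟨φ₀, hφD⟩ hφ₀
  rw [coe_primesEquiv_eq_three hv, cuspCoeff_liftToGamma1_eq_lFunction hf,
    lFunction_three_eq_zero_of_classO6 W hO6, nebentypus_liftToGamma1_apply_three hf h3N] at hE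
  set ρ' := FramedGaloisRep.toGaloisRep ((VQ.baseChange (algebraMap ℚ_[ℓ] (PadicAlgCl ℓ))
    (continuous_algebraMap_padicAlgCl ℓ)).twist ψ) with hρ'
  have hrev : (ρ'.toInertiaCoinvariants 𝔓 ⟨φ₀, hφD⟩).charpoly.reverse = 1 := by
    apply Polynomial.map_injective (ι : PadicAlgCl ℓ →+* ℂ) ι.injective
    rw [hE]
    simp
  have hunit : IsUnit (ρ'.toInertiaCoinvariants 𝔓 ⟨φ₀, hφD⟩) := by
    rw [← Representation.asGroupHom_apply]; exact Units.isUnit _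
  have h0 := finrank_eq_zero_of_charpoly_reverse_eq_one _ hunit hrev
  -- cyclicity through `τ` and the dimension of the coinvariants
  have hτD : τ ∈ 𝔓.decompositionSubgroup (absoluteGaloisGroup ℚ) := 𝔓.inertia_le_stabilizer hτ
  have hcyc := forall_inertia_twist_eq_pow W ℓ hO6 hev hsq hℓ ι heV 1 hψ hv h𝔓 hτ hχτ
  have hcyc' : ∀ s ∈ 𝔓.inertia (𝔓.decompositionSubgroup (absoluteGaloisGroup ℚ)), ∃ j : ℕ,
      ρ'.restrictDecomposition 𝔓 s =
        ρ'.restrictDecomposition 𝔓 ⟨τ, hτD⟩ ^ j := by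
    intro s hs
    obtain ⟨j, hj⟩ := hcyc s hs
    exact ⟨j, by rw [ContinuousRep.restrictDecomposition_apply, ContinuousRep.restrictDecomposition_apply, hj]⟩
  have hτI : (⟨τ, hτD⟩ : 𝔓.decompositionSubgroup (absoluteGaloisGroup ℚ)) ∈
      𝔓.inertia (𝔓.decompositionSubgroup (absoluteGaloisGroup ℚ)) := hτ
  have hdim := CoinvariantEigenvalue.finrank_coinvariants_eq_finrank_ker (ρ'.restrictDecomposition 𝔓)
    (𝔓.inertia (𝔓.decompositionSubgroup (absoluteGaloisGroup ℚ))) hτI hcyc'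
  rw [ContinuousRep.restrictDecomposition_apply] at hdim
  have hker : Module.finrank (PadicAlgCl ℓ) (LinearMap.ker (ρ' τ - 1)) = 0 := by
    rw [← hdim]; exact h0
  rw [Submodule.finrank_eq_zero] at hker
  -- `ψ(τ) = 1`
  have hψτ : (ψ τ : PadicAlgCl ℓ) = 1 := by
    rw [hψ, MulChar.one_apply (Units.isUnit _), map_one]
  have hfix : ∀ w : Fin 2 → PadicAlgCl ℓ,
      ((((VQ τ : GL (Fin 2) ℚ_[ℓ]) : Matrix (Fin 2) (Fin 2) ℚ_[ℓ]).map (algebraMap ℚ_[ℓ] (PadicAlgCl ℓ))) *ᵥ w)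
        = w → w = 0 := by
    intro w hw
    have hmem : w ∈ LinearMap.ker (ρ' τ - 1) := by
      rw [LinearMap.mem_ker, LinearMap.sub_apply, hρ', toGaloisRep_twist_apply, hψτ, one_smul, hw,
        Module.End.one_apply, sub_self]
    rw [hker] at hmem
    exact (Submodule.mem_bot _).mp hmem
  exact forall_rationalGaloisRepTate_fixed_eq_zero_of_framed W ℓ heV hfix y hy

/-! ### §5 Claim (B): `ρ(τ) ≠ −1` — Carayol for the newform of `f_W ⊗ ψ₃` -/

/-- **Claim (B): on a principal-series row `ρ(τ) ≠ −1` on `V_ℓ(W)`** (`τ ∈ I_𝔓`, `χ₉(τ) = 2`, `ℓ ≠ 3`), granted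
Deligne's representations and Carayol's Euler factors. Proof: if `ρ(τ) = −1` then `V_ℓ(W) ⊗ ψ₃` (`ψ₃ = (·/3)`,
`ψ₃(χ₃ τ) = ψ₃(2) = −1`) is TRIVIAL on `I_𝔓` (the inertia acts through the powers of `τ`), so its inertia
coinvariants are the whole plane; for the newform `g₀` of `f_W ⊗ ψ₃` (trivial nebentypus, level `N₀ ∣ 9N`) the
engine gives `det(1 − Frob T | plane) = 1 − a₃(g₀)T + ε_{g₀}(3)·3T²`, whose `T²`-coefficient `det ≠ 0` forces
`ε_{g₀}(3) ≠ 0`, i.e. `3 ∤ N₀` — contradicting `three_dvd_level_of_psiThree_packet` (untwist + strong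
multiplicity one on `Γ₀` + `27 ∣ N`). [cite: CarayolASENS1986, Thm. (A)] [cite: AtkinLehner1970, Thm. 4] -/
theorem rationalGaloisRepTate_ne_neg_one
    (hDel : Hida2000_thm326_exists_galoisRep) (hCar : Carayol1986_eulerFactor)
    (hO6 : ClassO6 W 3) (hev : Even (padicValInt 3 W.minimalDiscriminantInt))
    (hsq : W.minimalDiscriminantInt / 3 ^ padicValInt 3 W.minimalDiscriminantInt % 3 = 1) (hℓ : ℓ ≠ 3)
    {N : ℕ} [NeZero N] {f : CuspForm (Gamma0 N) 2} (hf : IsNewformOf W f) (h27 : 27 ∣ N)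
    {v : HeightOneSpectrum (𝓞 ℚ)} (hv : (3 : 𝓞 ℚ) ∈ v.asIdeal)
    {𝔓 : Ideal (absIntegers (𝓞 ℚ) ℚ)} (h𝔓 : 𝔓 ∈ v.primesAbove)
    {τ : absoluteGaloisGroup ℚ} (hτ : τ ∈ 𝔓.inertia (absoluteGaloisGroup ℚ))
    (hχτ : (modNCyclotomicCharacter ℚ 9 τ : ZMod 9) = 2) :
    W.rationalGaloisRepTate ℓ τ ≠ -1 := by
  classical
  intro hneg
  haveI : NeZero ((3 : ℕ) : ℚ) := ⟨by norm_num⟩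
  haveI : 𝔓.IsPrime := h𝔓.1
  obtain ⟨ι⟩ := PadicAlgCl.nonempty_ringEquiv_complex ℓ
  obtain ⟨VQ, eV, heV, hV⟩ := exists_framedGaloisRep_rationalTate W ℓ
  obtain ⟨ψ, hψ, hψI, hψF⟩ := exists_psi_of_dirichletCharacter_three ℓ ι psiThree
  -- the newform of `f_W ⊗ ψ₃`, trivial nebentypus
  obtain ⟨N₀, _, hN₀, g₀, hg₀, hε, hpk⟩ := exists_psiThree_twist_newform hf
  obtain ⟨ρg, hρg, hirr⟩ := hDel g₀ le_rfl hg₀ ℓ ι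
  obtain ⟨φ₀, hφ₀⟩ := HeightOneSpectrum.exists_isArithFrobAt_of_mem_primesAbove_holds h𝔓
  have hφD : φ₀ ∈ 𝔓.decompositionSubgroup (absoluteGaloisGroup ℚ) := hφ₀.mem_stabilizer
  -- the engine: Carayol's coinvariant Euler factor of `V_ℓ(W) ⊗ ψ₃` at `3`
  have hE := map_reverse_charpoly_toInertiaCoinvariants_twist_eq W ℓ ι VQ hV 3
    (fun n : ℕ ↦ psiThree (n : ZMod 3)) ψ hψI hψF g₀ hg₀
    (T₀ := N * 3) (mul_ne_zero (NeZero.ne N) three_ne_zero) hpk ρg hρg hirr hCar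
    (WeierstrassCurve.nodalCubic.natCast_not_mem_of_three_mem ℓ hℓ hv) h𝔓 ⟨φ₀, hφD⟩ hφ₀
  rw [coe_primesEquiv_eq_three hv] at hE
  set ρ' := FramedGaloisRep.toGaloisRep ((VQ.baseChange (algebraMap ℚ_[ℓ] (PadicAlgCl ℓ))
    (continuous_algebraMap_padicAlgCl ℓ)).twist ψ) with hρ'
  -- `ρ'(τ) = 1`: `VQ(τ) = −1` and `ψ₃(χ₃ τ) = ψ₃(2) = −1`
  have hψτ : (ψ τ : PadicAlgCl ℓ) = -1 := by
    rw [hψ, modNCyclotomicCharacter_three_eq_two hχτ, psiThree_two, map_neg, map_one]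
  have hρτ : ρ' τ = 1 := toGaloisRep_twist_eq_one_of_neg VQ ψ
    (coe_framed_eq_neg_one_of_rationalGaloisRepTate_eq_neg_one W ℓ heV hneg) hψτ
  -- the coinvariants are the whole plane
  have hτD : τ ∈ 𝔓.decompositionSubgroup (absoluteGaloisGroup ℚ) := 𝔓.inertia_le_stabilizer hτ
  have hcyc := forall_inertia_twist_eq_pow W ℓ hO6 hev hsq hℓ ι heV psiThree hψ hv h𝔓 hτ hχτ
  have hcyc' : ∀ s ∈ 𝔓.inertia (𝔓.decompositionSubgroup (absoluteGaloisGroup ℚ)), ∃ j : ℕ,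
      ρ'.restrictDecomposition 𝔓 s =
        ρ'.restrictDecomposition 𝔓 ⟨τ, hτD⟩ ^ j := by
    intro s hs
    obtain ⟨j, hj⟩ := hcyc s hs
    exact ⟨j, by rw [ContinuousRep.restrictDecomposition_apply, ContinuousRep.restrictDecomposition_apply, hj]⟩
  have hτI : (⟨τ, hτD⟩ : 𝔓.decompositionSubgroup (absoluteGaloisGroup ℚ)) ∈
      𝔓.inertia (𝔓.decompositionSubgroup (absoluteGaloisGroup ℚ)) := hτ
  have hdim := CoinvariantEigenvalue.finrank_coinvariants_eq_finrank_ker (ρ'.restrictDecomposition 𝔓)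
    (𝔓.inertia (𝔓.decompositionSubgroup (absoluteGaloisGroup ℚ))) hτI hcyc'
  rw [ContinuousRep.restrictDecomposition_apply, hρτ, sub_self, LinearMap.ker_zero, finrank_top,
    Module.finrank_fin_fun] at hdim
  -- `T²`-coefficient of the coinvariant Euler factor: `det ≠ 0`
  have hunit : IsUnit (ρ'.toInertiaCoinvariants 𝔓 ⟨φ₀, hφD⟩) := by
    rw [← Representation.asGroupHom_apply]; exact Units.isUnit _
  have hc := coeff_reverse_charpoly_finrank_ne_zero _ hunit
  rw [hdim] at hc
  have hc' := congrArg (fun q : ℂ[X] ↦ q.coeff 2) hE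
  simp only [Polynomial.coeff_map, coeff_add, coeff_sub, coeff_one, coeff_C_mul, coeff_X_pow, coeff_X,
    if_true, RingHom.coe_coe] at hc'
  norm_num at hc'
  -- `ε_{g₀}(3) ≠ 0`, hence `3 ∤ N₀`
  have hε3 : (nebentypus g₀ ((3 : ℕ) : ZMod N₀) : ℂ) ≠ 0 := by
    intro h0
    rw [Nat.cast_ofNat] at h0
    rw [h0, zero_mul] at hc'
    exact hc (ι.injective (by rw [hc', map_zero]))
  have hnd : ¬ 3 ∣ N₀ := not_three_dvd_of_nebentypus_one_apply_ne_zero hε hε3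
  -- but the quadratic untwist keeps `3` in the level
  have hpk' : ∀ p : ℕ, p.Prime → ¬ p ∣ N * 3 → cuspCoeff g₀ p = psiThree (p : ZMod 3) * cuspCoeff f p := by
    intro p hp hpN
    rw [(hpk p hp hpN).1, hf.2 p]
  exact hnd (three_dvd_level_of_psiThree_packet hf.1 h27 hg₀ hε (mul_ne_zero (NeZero.ne N) three_ne_zero) hpk')

/-! ### §6 The binder `hwild`: an inertia element at `3` of exact order `3` on `V_ℓ(W)` -/

/-- **Wild inertia at `3` on the principal-series rows** (the lead's binder `hwild`, any `ℓ ≠ 3`): for `W`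
non-trivially on a principal-series row (`ClassO6`, `v₃(Δ_min)` even, unit part `≡ 1 mod 3`), with newform `f`
of level `N = N_W` (modularity with Carayol's level), and granted Deligne's representations and Carayol's Euler
factors, there are a place `v ∋ 3`, a prime `𝔓 ∣ v` of `ℤ̄` and `i ∈ I_𝔓` with `ρ_{W,ℓ}(i)³ = 1 ≠ ρ_{W,ℓ}(i)`:
`i = τ²` for `τ ∈ I_𝔓` with `χ₉(τ) = 2` (`ρ(τ)⁶ = 1` as `τ⁶` fixes `ζ₉`; `ρ(τ)² ≠ 1` by Claims (A) and (B)).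
[cite: CarayolASENS1986, Thm. (A)] [cite: Hida2000, Thm. 3.26 (1)] [cite: SerreTate1968, §2] -/
theorem hwild_of_classO6_of_print
    (hDel : Hida2000_thm326_exists_galoisRep) (hCar : Carayol1986_eulerFactor)
    (hO6 : ClassO6 W 3) (hev : Even (padicValInt 3 W.minimalDiscriminantInt))
    (hsq : W.minimalDiscriminantInt / 3 ^ padicValInt 3 W.minimalDiscriminantInt % 3 = 1) (hℓ : ℓ ≠ 3)
    {N : ℕ} [NeZero N] (f : CuspForm (Gamma0 N) 2) (hf : IsNewformOf W f) (hN : N = W.conductorNorm ℤ) :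
    ∃ (v : HeightOneSpectrum (𝓞 ℚ)) (𝔓 : Ideal (absIntegers (𝓞 ℚ) ℚ)), 𝔓 ∈ v.primesAbove ∧
      (3 : 𝓞 ℚ) ∈ v.asIdeal ∧ ∃ i ∈ 𝔓.inertia (absoluteGaloisGroup ℚ),
        W.rationalGaloisRepTate ℓ i ^ 3 = 1 ∧ W.rationalGaloisRepTate ℓ i ≠ 1 := by
  classical
  haveI : NeZero ((9 : ℕ) : ℚ) := ⟨by norm_num⟩
  -- the level is divisible by `27`
  have h27 : 27 ∣ N := by
    have h := pow_three_dvd_conductorNorm_of_classO6 W hO6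
    rw [← hN] at h
    simpa using h
  have h3N : 3 ∣ N := (show (3 : ℕ) ∣ 27 by norm_num).trans h27
  -- the place of `3`, a prime of `ℤ̄` above it, and `τ ∈ I_𝔓` with `χ₉(τ) = 2`
  set v : HeightOneSpectrum (𝓞 ℚ) := (primesEquiv (R := 𝓞 ℚ)).symm ⟨3, Nat.prime_three⟩ with hvdef
  have hv : (3 : 𝓞 ℚ) ∈ v.asIdeal := by
    have h := (natCast_mem_asIdeal_iff_eq_primesEquiv_symm v Nat.prime_three).mpr hvdef
    simpa using h
  obtain ⟨𝔓, h𝔓⟩ := v.primesAbove_nonempty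
  obtain ⟨τ, hτ, hχτu⟩ := exists_mem_inertia_modNCyclotomicCharacter_nine_eq hv h𝔓
    (ZMod.unitOfCoprime 2 (by norm_num : Nat.Coprime 2 9))
  have hχτ : (modNCyclotomicCharacter ℚ 9 τ : ZMod 9) = 2 := by
    rw [hχτu, ZMod.coe_unitOfCoprime, Nat.cast_ofNat]
  refine ⟨v, 𝔓, h𝔓, hv, τ ^ 2, Subgroup.pow_mem _ hτ 2, ?_, ?_⟩
  · -- `ρ(τ²)³ = ρ(τ⁶) = 1`: `τ⁶` fixes `ζ₉`
    have h6 : modNCyclotomicCharacter ℚ 9 (τ ^ 6) = 1 := by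
      apply Units.ext
      rw [map_pow, Units.val_pow_eq_pow_val, hχτ, Units.val_one]
      decide
    have hW6 : W.rationalGaloisRepTate ℓ (τ ^ 6) = 1 := LinearMap.ext fun x ↦
      rationalGaloisRepTate_apply_eq_self_of_mem_inertia_of_modNCyclotomicCharacter_eq_one W hO6 hev hsq ℓ
        hℓ hv h𝔓 (Subgroup.pow_mem _ hτ 6) h6 x
    rw [← map_pow, ← pow_mul]
    exact hW6
  · -- `ρ(τ²) ≠ 1`: otherwise `ρ(τ) = −1` by Claim (A), contradicting Claim (B)
    intro h1
    have hsq1 : W.rationalGaloisRepTate ℓ τ ^ 2 = 1 := by rw [← map_pow]; exact h1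
    have hinj := forall_eq_zero_of_rationalGaloisRepTate_apply_eq_self W ℓ hDel hCar hO6 hev hsq hℓ hf h3N
      hv h𝔓 hτ hχτ
    exact rationalGaloisRepTate_ne_neg_one W ℓ hDel hCar hO6 hev hsq hℓ hf h27 hv h𝔓 hτ hχτ
      (eq_neg_one_of_sq_eq_one_of_forall _ hinj hsq1)

/-- **The lead's binder `hwild` verbatim (`ℓ = 2`)**: on a principal-series row, granted Deligne's
representations and Carayol's Euler factors and the newform of `W` at level `N_W`, some inertia element at `3`
acts on `V₂(W)` with exact order `3`. [cite: CarayolASENS1986, Thm. (A)] [cite: Hida2000, Thm. 3.26 (1)] -/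
theorem hwild_two_of_classO6_of_print
    (hDel : Hida2000_thm326_exists_galoisRep) (hCar : Carayol1986_eulerFactor)
    (hO6 : ClassO6 W 3) (hev : Even (padicValInt 3 W.minimalDiscriminantInt))
    (hsq : W.minimalDiscriminantInt / 3 ^ padicValInt 3 W.minimalDiscriminantInt % 3 = 1)
    {N : ℕ} [NeZero N] (f : CuspForm (Gamma0 N) 2) (hf : IsNewformOf W f) (hN : N = W.conductorNorm ℤ) :
    haveI : Fact (Nat.Prime 2) := ⟨Nat.prime_two⟩
    ∃ (v : HeightOneSpectrum (𝓞 ℚ)) (𝔓 : Ideal (absIntegers (𝓞 ℚ) ℚ)), 𝔓 ∈ v.primesAbove ∧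
      (3 : 𝓞 ℚ) ∈ v.asIdeal ∧ ∃ i ∈ 𝔓.inertia (absoluteGaloisGroup ℚ),
        W.rationalGaloisRepTate 2 i ^ 3 = 1 ∧ W.rationalGaloisRepTate 2 i ≠ 1 :=
  haveI : Fact (Nat.Prime 2) := ⟨Nat.prime_two⟩
  hwild_of_classO6_of_print W 2 hDel hCar hO6 hev hsq (by norm_num) f hf hN

/-! ### §7 The binder `hwild` in the lead's landed currency (`χ₉(i) = 4`) -/

/-- **Wild inertia at `3`, in the currency of the lead's `UniformRootLaw.uniformRootLaw_of_print`** (p650112):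
on a principal-series row, granted Deligne's representations and Carayol's Euler factors and the newform of `W` at
level `N_W`, there is an inertia element `i` at `3` with `χ₉(i) = 4` acting non-trivially on `V_ℓ(W)` (`ℓ ≠ 3`) —
`i = τ²` for `τ ∈ I_𝔓` with `χ₉(τ) = 2`; `ρ(τ²) ≠ 1` by Claims (A) and (B).
[cite: CarayolASENS1986, Thm. (A)] [cite: Hida2000, Thm. 3.26 (1)] [cite: SerreTate1968, §2] -/
theorem hwild_eq_four_of_classO6_of_print
    (hDel : Hida2000_thm326_exists_galoisRep) (hCar : Carayol1986_eulerFactor)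
    (hO6 : ClassO6 W 3) (hev : Even (padicValInt 3 W.minimalDiscriminantInt))
    (hsq : W.minimalDiscriminantInt / 3 ^ padicValInt 3 W.minimalDiscriminantInt % 3 = 1) (hℓ : ℓ ≠ 3)
    {N : ℕ} [NeZero N] (f : CuspForm (Gamma0 N) 2) (hf : IsNewformOf W f) (hN : N = W.conductorNorm ℤ) :
    ∃ (v : HeightOneSpectrum (𝓞 ℚ)) (𝔓 : Ideal (absIntegers (𝓞 ℚ) ℚ)), 𝔓 ∈ v.primesAbove ∧
      (3 : 𝓞 ℚ) ∈ v.asIdeal ∧ ∃ i ∈ 𝔓.inertia (absoluteGaloisGroup ℚ),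
        (modNCyclotomicCharacter ℚ 9 i : ZMod 9) = 4 ∧ W.rationalGaloisRepTate ℓ i ≠ 1 := by
  classical
  haveI : NeZero ((9 : ℕ) : ℚ) := ⟨by norm_num⟩
  have h27 : 27 ∣ N := by
    have h := pow_three_dvd_conductorNorm_of_classO6 W hO6
    rw [← hN] at h
    simpa using h
  have h3N : 3 ∣ N := (show (3 : ℕ) ∣ 27 by norm_num).trans h27
  set v : HeightOneSpectrum (𝓞 ℚ) := (primesEquiv (R := 𝓞 ℚ)).symm ⟨3, Nat.prime_three⟩ with hvdef
  have hv : (3 : 𝓞 ℚ) ∈ v.asIdeal := by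
    have h := (natCast_mem_asIdeal_iff_eq_primesEquiv_symm v Nat.prime_three).mpr hvdef
    simpa using h
  obtain ⟨𝔓, h𝔓⟩ := v.primesAbove_nonempty
  obtain ⟨τ, hτ, hχτu⟩ := exists_mem_inertia_modNCyclotomicCharacter_nine_eq hv h𝔓
    (ZMod.unitOfCoprime 2 (by norm_num : Nat.Coprime 2 9))
  have hχτ : (modNCyclotomicCharacter ℚ 9 τ : ZMod 9) = 2 := by
    rw [hχτu, ZMod.coe_unitOfCoprime, Nat.cast_ofNat]
  refine ⟨v, 𝔓, h𝔓, hv, τ ^ 2, Subgroup.pow_mem _ hτ 2, ?_, ?_⟩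
  · rw [map_pow, Units.val_pow_eq_pow_val, hχτ]
    norm_num
  · intro h1
    have hsq1 : W.rationalGaloisRepTate ℓ τ ^ 2 = 1 := by rw [← map_pow]; exact h1
    have hinj := forall_eq_zero_of_rationalGaloisRepTate_apply_eq_self W ℓ hDel hCar hO6 hev hsq hℓ hf h3N
      hv h𝔓 hτ hχτ
    exact rationalGaloisRepTate_ne_neg_one W ℓ hDel hCar hO6 hev hsq hℓ hf h27 hv h𝔓 hτ hχτ
      (eq_neg_one_of_sq_eq_one_of_forall _ hinj hsq1)

/-- **The lead's binder `hwild` VERBATIM, `ℓ = 2`, `χ₉(i) = 4` currency** (hypothesis of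
`UniformRootLaw.uniformRootLaw_of_print`, p650112): on a principal-series row, granted Deligne's representations,
Carayol's Euler factors and the newform of `W` at level `N_W`. [cite: CarayolASENS1986, Thm. (A)]
[cite: Hida2000, Thm. 3.26 (1)] -/
theorem hwild_two_eq_four_of_classO6_of_print
    (hDel : Hida2000_thm326_exists_galoisRep) (hCar : Carayol1986_eulerFactor)
    (hO6 : ClassO6 W 3) (hev : Even (padicValInt 3 W.minimalDiscriminantInt))
    (hsq : W.minimalDiscriminantInt / 3 ^ padicValInt 3 W.minimalDiscriminantInt % 3 = 1)
    {N : ℕ} [NeZero N] (f : CuspForm (Gamma0 N) 2) (hf : IsNewformOf W f) (hN : N = W.conductorNorm ℤ) :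
    haveI : Fact (Nat.Prime 2) := ⟨Nat.prime_two⟩
    ∃ (v : HeightOneSpectrum (𝓞 ℚ)) (𝔓 : Ideal (absIntegers (𝓞 ℚ) ℚ)), 𝔓 ∈ v.primesAbove ∧
      (3 : 𝓞 ℚ) ∈ v.asIdeal ∧ ∃ i ∈ 𝔓.inertia (absoluteGaloisGroup ℚ),
        (modNCyclotomicCharacter ℚ 9 i : ZMod 9) = 4 ∧ W.rationalGaloisRepTate 2 i ≠ 1 :=
  haveI : Fact (Nat.Prime 2) := ⟨Nat.prime_two⟩
  hwild_eq_four_of_classO6_of_print W 2 hDel hCar hO6 hev hsq (by norm_num) f hf hN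

/-! ### §8 The lead's registered stub `stub_WILD` from modularity and the two print facts -/

/-- **The K1 lead's registered stub `stub_WILD` (skeleton v7 on stmt-21580/21581) ⟸ three named print facts**:
modularity (`nonempty_modularParametrizationData`, supplying the newform of `W` at level `N_W`), Deligne's
representations (`Hida2000_thm326_exists_galoisRep`) and Carayol's Euler factors (`Carayol1986_eulerFactor`) give,
on EVERY principal-series row, an inertia element at `3` with `χ₉ = 4` acting non-trivially on `V₂(W)` — the
conclusion is the stub's text verbatim. [cite: CarayolASENS1986, Thm. (A)] [cite: Hida2000, Thm. 3.26 (1)]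
[cite: BreuilConradDiamondTaylor2001, Thm. A] -/
theorem stub_WILD_of_print (hmod : nonempty_modularParametrizationData)
    (hDel : Hida2000_thm326_exists_galoisRep) (hCar : Carayol1986_eulerFactor) :
    ∀ (W : WeierstrassCurve ℚ) [W.IsElliptic] [W.IsGloballyMinimal],
      Summit.BirchSwinnertonDyer.Rank1Residual.Additive.ClassO6 W 3 →
      Even (padicValInt 3 W.minimalDiscriminantInt) →
      W.minimalDiscriminantInt / 3 ^ padicValInt 3 W.minimalDiscriminantInt % 3 = 1 →
      ∃ (v : IsDedekindDomain.HeightOneSpectrum (NumberField.RingOfIntegers ℚ))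
        (𝔓 : Ideal (Literature.NumberTheory.GaloisRepresentations.absIntegers (NumberField.RingOfIntegers ℚ) ℚ)),
        𝔓 ∈ v.primesAbove ∧ (3 : NumberField.RingOfIntegers ℚ) ∈ v.asIdeal ∧
        ∃ i ∈ 𝔓.inertia (Field.absoluteGaloisGroup ℚ),
          (Literature.NumberTheory.GaloisRepresentations.modNCyclotomicCharacter ℚ 9 i : ZMod 9) = 4 ∧
            W.rationalGaloisRepTate 2 i ≠ 1 := by
  intro W _ _ hO6 hev hsq
  haveI : NeZero (W.conductorNorm ℤ) := ⟨(W.conductorNorm_pos_holds).ne'⟩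
  obtain ⟨Dm⟩ := hmod W
  exact hwild_two_eq_four_of_classO6_of_print W hDel hCar hO6 hev hsq Dm.f Dm.isNewformOf rfl

end Claims

end Summit.BirchSwinnertonDyer.BirchSwinnertonDyer.Theorems.InertiaWildAtThree

end
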